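import Summits.QuantumFields.YangMills.Theorems.BalabanUVNodesRateCarriersOfRecord13CoPH
import Literature.MathematicalPhysics.QuantumFieldTheory.Balaban1983to89.Node00.U3OfKernels
import Literature.MathematicalPhysics.QuantumFieldTheory.Balaban1983to89.T4TowerRateComposition

/-!
# BalabanUVNodes ∕ N18 — NODE N18 = NE5 AT THE KERNEL OBJECTS OF RECORD (node00-def-W1's `Node00/U3OfKernels`, W1-19):
# the N18 slot as the η-RATE OF CONSECUTIVE-LEVEL LIMITING (1.21) KERNELS, and THE FAMILY REDUCTION BY N22 — at node U3's
# objects of record run B's first-coupling family IS run A's functional ONE LEVEL UP with the unpaired coupling `b` PREPENDED,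
# so N22's history-Lipschitz letter with fading memory collapses `N18At`'s quantifier `∀ b ∈ ]0, γ]` to ONE member `b₀`
# (Track A, DAG node N18 = NE5 `T4OutputRate.NE5 EA EB W κ θ C₅`; cluster K4 «SpineRates»; key K3⁷ `SpineGivenEndpointR13SepCoPH`)

HONEST FRAMING.  Count-neutral kernel bookkeeping (seat `pub-ymgap-dag-n18-w1` g2; `--supports stmt-QuantumFields-20544`, helper
lane), LOCATED: every analytic input below — NE9 ∕ fading memory of run A's limiting kernels (node N22's content) and NE5 at ONE
member (node N18's content) — is a HYPOTHESIS on Bałaban's objects and is NOT supplied; the theorems are real-number bookkeeping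
over node00-def-W1's kernel-keyed objects BY NAME (`U3OfKernels.EA ∕ EB ∕ kernelA ∕ objects ∕ objectsOfRecord₁₃`, faces
`EB_pt_eq_EA_succ`, `ne5_iff`, `ne9_EA_iff`, `prependCoupling_mem_window`) and the (T-RATE) pen's ₁₃ bundle `u3OfRecord₁₃` ∕
`rateCarriersOfRecord₁₃CoPH`.  Nothing of Bałaban's is asserted; NE5 ∕ NE9 are NOT PRINTED ([Balaban1987RG1] Thm 1 p. 259 gives
uniformity in the spacing only; p. 263 *«It is a C^∞-function of g_{j−1} ∈ [0, γ]»*; pp. 256 ∕ 298 the dependence on the preceding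
couplings in words) and NOT PROVED here; N18 is NOT discharged; K3⁷ OPEN and not claimed; counts unmoved.  One finite four-torus
programme at fixed ε — R4 closes the conditional rung `BalabanLadder.UV` only; nothing continuum ∕ ℝ⁴ ∕ OS ∕ mass gap ∕ Clay.
THEOREMS ONLY: 0 `def`, 0 `sorry`, standard axioms.

THE POINT.  Node U3's objects of record are now KEYED TO THE LIMITING KERNELS `Π_{k+1,μν}(g_0, …, g_k; z)` of [I] (1.20)–(1.21)
(`Node00/U3OfKernels`, p590183): run A's level functional STORES `kernelA g k μ ν z`, and run B's first-coupling family is, BY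
CONSTRUCTION, run A's functional ONE LEVEL UP along the PREPENDED sequence — `EB b g U (k,μ,ν,z) = EA (b ∷ g) U (k+1,μ,ν,z)`
(`U3OfKernels.EB_pt_eq_EA_succ`; the same convention as `U3Tower₁₁.EB`).  Consequently:
* the N18 slot `N18At (u3OfRecord₁₃ θ (objects F ℰ ρ bV ℓ) k)` READS (§3, `Iff`): for every member `b ∈ ]0, θ.γ]` and every
  coupling sequence of the window, `|Π_{j+1}(g; z) − Π_{j+2}(b, g; z)| ≤ C₅ θ₅^{j+1} e^{−κ|z|₁}` — the η-RATE OF CONSECUTIVE-LEVEL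
  LIMITING KERNELS (W1-19's `ne5_iff`, member by member; n18-w3's `n18At_u3OfRecord₁₃_ofFixed_iff` is the `NE5`-level face);
* THE FAMILY REDUCTION (§1 generic, §2 at the kernel objects, §3 at the ₁₃ bundle ∕ the record ∕ the pinned reading, §4 the tower
  twin): node N22's letter on the SAME bundle — `NE9` for run A's functional with moduli `Λ` of FADING MEMORY `Λ a i ≤ C₉ω^{a−i}` —
  bounds the spread of run B's family in its unpaired coupling, `|EB b g U X − EB b′ g U X| ≤ C₉·ω^{scale X}·|b − b′|·e^{−κ d X}`
  (only the history index `0` of the prepended sequences differs), so NE5 at ONE member `b₀ ∈ ]0, γ]` with constant `C₅` gives NE5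
  at EVERY member with constant `C₅ + C₉γ` at the same rate `θ ≥ ω`.  At the ₁₃ bundle: `N22At` (any run-length index — the kernel
  objects are level-free) + `ℓ.Signs` + the displayed letter relation `ℓ.ω ≤ ℓ.θ₅` + NE5 at one member with constant `ℓ.C₅ − ℓ.C₉·θ.γ`
  ⟹ `N18At`.  So of node N18's obligation at the reading of record only ONE member of run B's family carries content once node
  N22's slot is in hand — the `b`-dependence is node N22's fading memory of the OLDEST coupling.
* §5 (A6, referee standard): the §1 letters are JOINTLY inhabited by explicit ω-weighted history functionals on the kernel carrier
  with a COUPLING-SENSITIVE run-A functional and `C₅ = γω > 0` — a MODEL inhabitant, not Bałaban's.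
RELATION TO THE TREE: n22-e's `…N22AtRecordTowerKeyed` is the OPPOSITE edge (N18 at all lower levels + a regularity letter ⟹ N22);
here N22 is CONSUMED as a hypothesis and nothing of N22 is produced.  n18-w2's guard files (`…N18U3TowerGuards`, `…U3GuardsAtKernels`)
and n27-w1's (D4) producer (`…N27ReadOutAtU3OfKernels`) are disjoint from this file; their names are not re-declared (the level-free
bundle identity is unfolded by `rfl` where used).

Sources (types only): T. Bałaban, CMP **109** (1987) [Balaban1987RG1] (0.24)–(0.25) p. 257, Thm 1 p. 259, (1.18) p. 263, (1.20)–(1.22)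
p. 264, §5 p. 298; CMP **116** (1988) [Balaban1988RG2Cluster] (2.13) p. 14, (2.14) p. 15; C. King, CMP **102** (1986) [King1986] (3.73)
p. 665 (the printed model of an η-rate).  Nothing here is a claim about the Yang–Mills mass gap.
-/

noncomputable section

namespace YMDAG.N18.AtU3OfKernels

open scoped BigOperators
open Literature.MathematicalPhysics.QuantumFieldTheory.Balaban1983to89
open Literature.MathematicalPhysics.QuantumFieldTheory.Balaban1983to89.T4Continuum (T4Family ULoop)
open Literature.MathematicalPhysics.QuantumFieldTheory.Balaban1983to89.T4OutputRate (Carriers Functional Window NE5 NE9 FadingMemory)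
open Literature.MathematicalPhysics.QuantumFieldTheory.Balaban1983to89.B12Sec2to5 (l1)
open Literature.MathematicalPhysics.QuantumFieldTheory.Balaban1983to89.T4TowerRateComposition (fadingMemory_const_nonneg)
open Node00 (prependCoupling prependCoupling_zero prependCoupling_succ U3Letters₁₁ U3Objects₁₁ U3Tower₁₁ Stage13Params Stage13HParams)
open Node00.U3OfKernels (carriers pt kernelA objects objectsOfRecord₁₃ EB_pt_eq_EA_succ ne5_iff ne9_EA_iff prependCoupling_mem_window)
open YMDAG.UVSplit

/-! ## §1 Generic: the spread of a PREPENDED first-coupling family under NE9 with fading memory; the family from one member -/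

section Generic

variable {C C' : Carriers}

/-- **THE HISTORY SUM OF TWO PREPENDED SEQUENCES**: `b ∷ g` and `b′ ∷ g` differ only at the history index `0`, so under fading memory
`Σ_{i<n} Λ n i · |(b ∷ g)_i − (b′ ∷ g)_i| ≤ C₉ ω^n |b − b′|` (the sum is `Λ n 0 |b − b′|` for `n ≥ 1`, empty for `n = 0`). [folklore] -/
theorem historySum_prepend_le {C₉ ω : ℝ} {Λ : ℕ → ℕ → ℝ} (hΛ : FadingMemory C₉ ω Λ) (b b' : ℝ) (g : ℕ → ℝ) (n : ℕ) :
    ∑ i ∈ Finset.range n, Λ n i * |prependCoupling b g i - prependCoupling b' g i| ≤ C₉ * ω ^ n * |b - b'| := by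
  cases n with
  | zero =>
    simp only [Finset.range_zero, Finset.sum_empty, pow_zero, mul_one]
    exact mul_nonneg (fadingMemory_const_nonneg hΛ) (abs_nonneg _)
  | succ n =>
    rw [Finset.sum_range_succ']
    have hz : ∑ i ∈ Finset.range n,
        Λ (n + 1) (i + 1) * |prependCoupling b g (i + 1) - prependCoupling b' g (i + 1)| = 0 := by
      refine Finset.sum_eq_zero fun i _ => ?_
      simp [prependCoupling_succ]
    rw [hz, zero_add, prependCoupling_zero, prependCoupling_zero]
    have h := (hΛ (n + 1) 0 (Nat.zero_le _)).2
    rw [Nat.sub_zero] at h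
    exact mul_le_mul_of_nonneg_right h (abs_nonneg _)

/-- **THE SPREAD OF A PREPENDED FAMILY UNDER NE9 WITH FADING MEMORY.**  Two pair-carrier structures `C` (where run B's family `EB`
lives) and `C′` (where a run-A-type functional `EA′` lives), a domain map `sh` that does not LOWER the creation scale and keeps the
tree length, a background map `τ`, and THE LINK `EB b g U X = EA′ (b ∷ g) (τ U) (sh X)` (run B's family is `EA′` along the prepended
sequence); prepending a member of `]0, γ]` maps the window `W` into `W′`.  Then NE9 for `EA′` on `W′` with moduli of fading memory
`Λ a i ≤ C₉ ω^{a−i}`, `0 ≤ ω ≤ 1`, gives for members `b, b′ ∈ ]0, γ]`: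
`|EB b g U X − EB b′ g U X| ≤ C₉ · ω^{scale X} · |b − b′| · e^{−κ d X}`. [folklore] -/
theorem eb_sub_eb_le_of_ne9_prepend (EA' : Functional C' C'.BgA) (EB : ℝ → Functional C C.BgB)
    (sh : C.Dom → C'.Dom) (τ : C.BgB → C'.BgA)
    (hsc : ∀ X, C.scale X ≤ C'.scale (sh X)) (hd : ∀ X, C'.d (sh X) = C.d X)
    (hlink : ∀ (b : ℝ) (g : ℕ → ℝ) (U : C.BgB) (X : C.Dom), EB b g U X = EA' (prependCoupling b g) (τ U) (sh X))
    {W W' : Set (ℕ → ℝ)} {γ κ C₉ ω : ℝ} {Λ : ℕ → ℕ → ℝ}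
    (hW : ∀ b : ℝ, 0 < b → b ≤ γ → ∀ g ∈ W, prependCoupling b g ∈ W')
    (h9 : NE9 EA' W' κ Λ) (hΛ : FadingMemory C₉ ω Λ) (hω0 : 0 ≤ ω) (hω1 : ω ≤ 1)
    {b b' : ℝ} (hb : 0 < b) (hbγ : b ≤ γ) (hb' : 0 < b') (hb'γ : b' ≤ γ) {g : ℕ → ℝ} (hg : g ∈ W)
    (U : C.BgB) (X : C.Dom) :
    |EB b g U X - EB b' g U X| ≤ C₉ * ω ^ C.scale X * |b - b'| * Real.exp (-(κ * C.d X)) := by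
  rw [hlink, hlink]
  have h := h9 _ (hW b hb hbγ g hg) _ (hW b' hb' hb'γ g hg) (τ U) (sh X)
  rw [hd] at h
  have hC₉ : 0 ≤ C₉ := fadingMemory_const_nonneg hΛ
  have hsum := historySum_prepend_le hΛ b b' g (C'.scale (sh X))
  have hpow : ω ^ C'.scale (sh X) ≤ ω ^ C.scale X := pow_le_pow_of_le_one hω0 hω1 (hsc X)
  have he := (Real.exp_pos (-(κ * C.d X))).le
  calc |EA' (prependCoupling b g) (τ U) (sh X) - EA' (prependCoupling b' g) (τ U) (sh X)|
      ≤ Real.exp (-(κ * C.d X)) *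
          ∑ i ∈ Finset.range (C'.scale (sh X)), Λ (C'.scale (sh X)) i * |prependCoupling b g i - prependCoupling b' g i| := h
    _ ≤ Real.exp (-(κ * C.d X)) * (C₉ * ω ^ C'.scale (sh X) * |b - b'|) := mul_le_mul_of_nonneg_left hsum he
    _ ≤ Real.exp (-(κ * C.d X)) * (C₉ * ω ^ C.scale X * |b - b'|) :=
        mul_le_mul_of_nonneg_left (mul_le_mul_of_nonneg_right (mul_le_mul_of_nonneg_left hpow hC₉) (abs_nonneg _)) he
    _ = C₉ * ω ^ C.scale X * |b - b'| * Real.exp (-(κ * C.d X)) := by ring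

/-- **THE FAMILY FROM ONE MEMBER.**  In the setting of `eb_sub_eb_le_of_ne9_prepend` (with `ω ≤ θ ≤ 1`): NE5 between run A's
functional `EA` and ONE member `EB b₀`, `b₀ ∈ ]0, γ]`, with rate `θ` and constant `C₅`, gives NE5 at EVERY member `b ∈ ]0, γ]` with the
same rate and constant `C₅ + C₉γ` — one triangle inequality through `EB b₀`, the spread bound, `ω^{s} ≤ θ^{s}`, `|b₀ − b| ≤ γ`. [folklore] -/
theorem ne5_family_of_member (EA : Functional C C.BgA) (EA' : Functional C' C'.BgA) (EB : ℝ → Functional C C.BgB)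
    (sh : C.Dom → C'.Dom) (τ : C.BgB → C'.BgA)
    (hsc : ∀ X, C.scale X ≤ C'.scale (sh X)) (hd : ∀ X, C'.d (sh X) = C.d X)
    (hlink : ∀ (b : ℝ) (g : ℕ → ℝ) (U : C.BgB) (X : C.Dom), EB b g U X = EA' (prependCoupling b g) (τ U) (sh X))
    {W W' : Set (ℕ → ℝ)} {γ κ C₉ ω : ℝ} {Λ : ℕ → ℕ → ℝ}
    (hW : ∀ b : ℝ, 0 < b → b ≤ γ → ∀ g ∈ W, prependCoupling b g ∈ W')
    (h9 : NE9 EA' W' κ Λ) (hΛ : FadingMemory C₉ ω Λ) (hω0 : 0 ≤ ω) {θ C₅ : ℝ} (hωθ : ω ≤ θ) (hθ1 : θ ≤ 1)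
    {b₀ : ℝ} (hb₀ : 0 < b₀) (hb₀γ : b₀ ≤ γ) (h5 : NE5 EA (EB b₀) W κ θ C₅) :
    ∀ b : ℝ, 0 < b → b ≤ γ → NE5 EA (EB b) W κ θ (C₅ + C₉ * γ) := by
  intro b hb hbγ g hg U X
  have h1 := h5 g hg U X
  have h2 := eb_sub_eb_le_of_ne9_prepend EA' EB sh τ hsc hd hlink hW h9 hΛ hω0 (hωθ.trans hθ1) hb₀ hb₀γ hb hbγ hg U X
  have hC₉ : 0 ≤ C₉ := fadingMemory_const_nonneg hΛ
  have hbb : |b₀ - b| ≤ γ := by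
    rw [abs_sub_le_iff]
    constructor <;> linarith
  have hpow : ω ^ C.scale X ≤ θ ^ C.scale X := pow_le_pow_left₀ hω0 hωθ _
  have hθpow : 0 ≤ θ ^ C.scale X := pow_nonneg (hω0.trans hωθ) _
  have he := (Real.exp_pos (-(κ * C.d X))).le
  calc |EA g (C.transport U) X - EB b g U X|
      ≤ |EA g (C.transport U) X - EB b₀ g U X| + |EB b₀ g U X - EB b g U X| := abs_sub_le _ _ _
    _ ≤ C₅ * θ ^ C.scale X * Real.exp (-(κ * C.d X)) +
          C₉ * ω ^ C.scale X * |b₀ - b| * Real.exp (-(κ * C.d X)) := add_le_add h1 h2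
    _ ≤ C₅ * θ ^ C.scale X * Real.exp (-(κ * C.d X)) + C₉ * θ ^ C.scale X * γ * Real.exp (-(κ * C.d X)) :=
        add_le_add le_rfl (mul_le_mul_of_nonneg_right
          (mul_le_mul (mul_le_mul_of_nonneg_left hpow hC₉) hbb (abs_nonneg _) (mul_nonneg hC₉ hθpow)) he)
    _ = (C₅ + C₉ * γ) * θ ^ C.scale X * Real.exp (-(κ * C.d X)) := by ring

end Generic

/-! ## §2 At node00-def-W1's kernel objects `U3OfKernels.objects F ℰ ρ bV ℓ`: the family from one member, NE5 and kernel currencies -/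

section Kernels

variable {𝔄 : Type*} [NormedRing 𝔄] [NormedAlgebra ℝ 𝔄]
variable {V : Type*} [NormedAddCommGroup V] [NormedSpace ℝ V] {ι : Type*} [Fintype ι]
variable (F : T4Family) (ℰ : Node00.TermFamily1 F 𝔄) (ρ : V →L[ℝ] 𝔄) (bV : Module.Basis ι ℝ V)

/-- **THE LINK AT THE KERNEL OBJECTS** (W1-19's `EB_pt_eq_EA_succ` at a general carrier point): run B's family is run A's functional
of the prepended sequence at the LEVEL-SHIFTED point `(k+1, μ, ν, z)`. [cite: Balaban1987RG1, (0.24)–(0.25) p.257] -/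
theorem EB_eq_EA_prepend_shift (b : ℝ) (g : ℕ → ℝ) (U : PUnit) (p : carriers.Dom) :
    Node00.U3OfKernels.EB F ℰ ρ bV b g U p = Node00.U3OfKernels.EA F ℰ ρ bV (prependCoupling b g) U (p.1 + 1, p.2) :=
  rfl

/-- **THE FAMILY FROM ONE MEMBER AT THE KERNEL OBJECTS** (NE5 currency): NE9 for run A's kernel functional on the window `]0, γ]^ℕ`
with moduli of fading memory (`C₉`, `ω`, `0 ≤ ω ≤ θ ≤ 1`) and NE5 at ONE member `b₀ ∈ ]0, γ]` with constant `C₅` give NE5 at EVERY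
member with constant `C₅ + C₉γ` (§1 with the level shift `(k,μ,ν,z) ↦ (k+1,μ,ν,z)`, which RAISES the scale by one and keeps `|z|₁`).
[cite: Balaban1987RG1, Thm 1 p.259 and §5 p.298] -/
theorem ne5_objects_family_of_member {γ κ C₉ ω : ℝ} {Λ : ℕ → ℕ → ℝ}
    (h9 : NE9 (Node00.U3OfKernels.EA F ℰ ρ bV) (Window γ) κ Λ) (hΛ : FadingMemory C₉ ω Λ) (hω0 : 0 ≤ ω)
    {θ C₅ : ℝ} (hωθ : ω ≤ θ) (hθ1 : θ ≤ 1) {b₀ : ℝ} (hb₀ : 0 < b₀) (hb₀γ : b₀ ≤ γ)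
    (h5 : NE5 (Node00.U3OfKernels.EA F ℰ ρ bV) (Node00.U3OfKernels.EB F ℰ ρ bV b₀) (Window γ) κ θ C₅) :
    ∀ b : ℝ, 0 < b → b ≤ γ → NE5 (Node00.U3OfKernels.EA F ℰ ρ bV) (Node00.U3OfKernels.EB F ℰ ρ bV b) (Window γ) κ θ (C₅ + C₉ * γ) :=
  ne5_family_of_member (C := carriers) (C' := carriers) (Node00.U3OfKernels.EA F ℰ ρ bV) (Node00.U3OfKernels.EA F ℰ ρ bV)
    (Node00.U3OfKernels.EB F ℰ ρ bV) (fun p => (p.1 + 1, p.2)) id (fun _ => Nat.le_succ _) (fun _ => rfl)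
    (EB_eq_EA_prepend_shift F ℰ ρ bV) (fun _ hb hbγ _ hg => prependCoupling_mem_window hb hbγ hg) h9 hΛ hω0 hωθ hθ1
    hb₀ hb₀γ h5

/-- **THE FAMILY FROM ONE MEMBER, KERNEL CURRENCY**: joint history-Lipschitz bounds on the limiting kernels with fading-memory
moduli and the η-rate between `Π_{k+1}(g; ·)` and `Π_{k+2}(b₀, g; ·)` at ONE `b₀ ∈ ]0, γ]` give the η-rate of consecutive-level kernels
for EVERY prepended `b ∈ ]0, γ]`, constant `C₅ + C₉γ`. [cite: Balaban1987RG1, (1.21) p.264 and §5 p.298] -/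
theorem kernelStepRate_family_of_member {γ κ C₉ ω : ℝ} {Λ : ℕ → ℕ → ℝ}
    (h9 : ∀ g ∈ Window γ, ∀ g' ∈ Window γ, ∀ (k : ℕ) (μ ν : Fin 4) (z : Fin 4 → ℤ),
      |kernelA F ℰ ρ bV g k μ ν z - kernelA F ℰ ρ bV g' k μ ν z| ≤
        Real.exp (-(κ * l1 z)) * ∑ i ∈ Finset.range (k + 1), Λ (k + 1) i * |g i - g' i|)
    (hΛ : FadingMemory C₉ ω Λ) (hω0 : 0 ≤ ω) {θ C₅ : ℝ} (hωθ : ω ≤ θ) (hθ1 : θ ≤ 1) {b₀ : ℝ} (hb₀ : 0 < b₀) (hb₀γ : b₀ ≤ γ)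
    (h5 : ∀ g ∈ Window γ, ∀ (k : ℕ) (μ ν : Fin 4) (z : Fin 4 → ℤ),
      |kernelA F ℰ ρ bV g k μ ν z - kernelA F ℰ ρ bV (prependCoupling b₀ g) (k + 1) μ ν z| ≤
        C₅ * θ ^ (k + 1) * Real.exp (-(κ * l1 z))) :
    ∀ b : ℝ, 0 < b → b ≤ γ → ∀ g ∈ Window γ, ∀ (k : ℕ) (μ ν : Fin 4) (z : Fin 4 → ℤ),
      |kernelA F ℰ ρ bV g k μ ν z - kernelA F ℰ ρ bV (prependCoupling b g) (k + 1) μ ν z| ≤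
        (C₅ + C₉ * γ) * θ ^ (k + 1) * Real.exp (-(κ * l1 z)) :=
  fun b hb hbγ => (ne5_iff F ℰ ρ bV b (Window γ) κ θ _).1
    (ne5_objects_family_of_member F ℰ ρ bV ((ne9_EA_iff F ℰ ρ bV _ κ Λ).2 h9) hΛ hω0 hωθ hθ1 hb₀ hb₀γ
      ((ne5_iff F ℰ ρ bV b₀ _ κ θ C₅).2 h5) b hb hbγ)

/-! ## §3 At the ₁₃ bundle of record `u3OfRecord₁₃ θ (objects …) k`: the N18 slot READ as a kernel step rate; N18 from N22 and ONE member -/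

variable {N : ℕ} [NeZero N]

/-- **WHAT THE N18 SLOT SAYS AT THE ₁₃ BUNDLE OF THE KERNEL OBJECTS** (any run-length index `k` — the objects are level-free): for every
member `b ∈ ]0, θ.γ]` of run B's family and every coupling sequence of the record's window, THE η-RATE OF CONSECUTIVE-LEVEL LIMITING
KERNELS `|Π_{j+1}(g; z)_{μν} − Π_{j+2}(b, g; z)_{μν}| ≤ ℓ.C₅ · ℓ.θ₅^{j+1} · e^{−ℓ.κ|z|₁}` (`N18At` unfolded; W1-19's `ne5_iff` per member).
[cite: Balaban1987RG1, Thm 1 p.259 and (1.21) p.264] -/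
theorem n18At_u3OfRecord₁₃_objects_iff_kernelStepRate (θ : Stage13Params F N) (ℓ : U3Letters₁₁) (k : ℕ) :
    N18At (u3OfRecord₁₃ θ (objects F ℰ ρ bV ℓ) k) ↔
      ∀ b : ℝ, 0 < b → b ≤ θ.γ → ∀ g ∈ Window θ.γ, ∀ (j : ℕ) (μ ν : Fin 4) (z : Fin 4 → ℤ),
        |kernelA F ℰ ρ bV g j μ ν z - kernelA F ℰ ρ bV (prependCoupling b g) (j + 1) μ ν z| ≤
          ℓ.C₅ * ℓ.θ₅ ^ (j + 1) * Real.exp (-(ℓ.κ * l1 z)) := by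
  show (∀ b : ℝ, 0 < b → b ≤ θ.γ →
      NE5 (Node00.U3OfKernels.EA F ℰ ρ bV) (Node00.U3OfKernels.EB F ℰ ρ bV b) (Window θ.γ) ℓ.κ ℓ.θ₅ ℓ.C₅) ↔ _
  exact forall₃_congr fun b _ _ => ne5_iff F ℰ ρ bV b (Window θ.γ) ℓ.κ ℓ.θ₅ ℓ.C₅

/-- **N18 AT THE ₁₃ BUNDLE OF THE KERNEL OBJECTS FROM N22 AND ONE MEMBER.**  `N22At` at the bundle (any run-length index `k′`: it is
NE9 for run A's kernel functional on `]0, θ.γ]^ℕ` with the moduli of record `ℓ.C₉·ℓ.ω^{a−i}` ∧ their fading memory), the letter signs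
`ℓ.Signs`, the displayed letter relation `ℓ.ω ≤ ℓ.θ₅` (the fading rate does not exceed the η-rate), and NE5 at ONE member
`b₀ ∈ ]0, θ.γ]` with constant `ℓ.C₅ − ℓ.C₉·θ.γ` ⟹ `N18At` at the bundle (every index `k`).  The `b`-dependence of node N18's
obligation is node N22's fading memory of the oldest coupling. [cite: Balaban1987RG1, Thm 1 p.259 and §5 p.298] -/
theorem n18At_u3OfRecord₁₃_objects_of_n22At_of_member (θ : Stage13Params F N) (ℓ : U3Letters₁₁) (hs : ℓ.Signs)
    (hωθ : ℓ.ω ≤ ℓ.θ₅) (k k' : ℕ) (h22 : N22At (u3OfRecord₁₃ θ (objects F ℰ ρ bV ℓ) k')) {b₀ : ℝ} (hb₀ : 0 < b₀)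
    (hb₀γ : b₀ ≤ θ.γ)
    (h5 : NE5 (Node00.U3OfKernels.EA F ℰ ρ bV) (Node00.U3OfKernels.EB F ℰ ρ bV b₀) (Window θ.γ) ℓ.κ ℓ.θ₅ (ℓ.C₅ - ℓ.C₉ * θ.γ)) :
    N18At (u3OfRecord₁₃ θ (objects F ℰ ρ bV ℓ) k) := by
  have h9 : NE9 (Node00.U3OfKernels.EA F ℰ ρ bV) (Window θ.γ) ℓ.κ ℓ.moduli := h22.1
  have hΛ : FadingMemory ℓ.C₉ ℓ.ω ℓ.moduli := h22.2
  have h := ne5_objects_family_of_member F ℰ ρ bV h9 hΛ hs.ω_nonneg hωθ hs.θ₅_lt_one.le hb₀ hb₀γ h5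
  rw [sub_add_cancel] at h
  exact h

/-- **PIN-FREE KERNEL CURRENCY OF THE SAME**: with the N22 letters stated directly on the limiting kernels (joint history-Lipschitz
bounds with the moduli of record) and the member's η-rate stated on the kernels, `N18At` at the ₁₃ bundle follows.
[cite: Balaban1987RG1, (1.21) p.264 and §5 p.298] -/
theorem n18At_u3OfRecord₁₃_objects_of_kernelLetters (θ : Stage13Params F N) (ℓ : U3Letters₁₁) (hs : ℓ.Signs)
    (hωθ : ℓ.ω ≤ ℓ.θ₅) (k : ℕ)
    (h9 : ∀ g ∈ Window θ.γ, ∀ g' ∈ Window θ.γ, ∀ (j : ℕ) (μ ν : Fin 4) (z : Fin 4 → ℤ),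
      |kernelA F ℰ ρ bV g j μ ν z - kernelA F ℰ ρ bV g' j μ ν z| ≤
        Real.exp (-(ℓ.κ * l1 z)) * ∑ i ∈ Finset.range (j + 1), ℓ.moduli (j + 1) i * |g i - g' i|)
    {b₀ : ℝ} (hb₀ : 0 < b₀) (hb₀γ : b₀ ≤ θ.γ)
    (h5 : ∀ g ∈ Window θ.γ, ∀ (j : ℕ) (μ ν : Fin 4) (z : Fin 4 → ℤ),
      |kernelA F ℰ ρ bV g j μ ν z - kernelA F ℰ ρ bV (prependCoupling b₀ g) (j + 1) μ ν z| ≤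
        (ℓ.C₅ - ℓ.C₉ * θ.γ) * ℓ.θ₅ ^ (j + 1) * Real.exp (-(ℓ.κ * l1 z))) :
    N18At (u3OfRecord₁₃ θ (objects F ℰ ρ bV ℓ) k) := by
  have h := kernelStepRate_family_of_member F ℰ ρ bV h9 (fun a i _ => ⟨hs.moduli_nonneg a i, le_rfl⟩) hs.ω_nonneg hωθ
    hs.θ₅_lt_one.le hb₀ hb₀γ h5
  rw [sub_add_cancel] at h
  exact (n18At_u3OfRecord₁₃_objects_iff_kernelStepRate F ℰ ρ bV θ ℓ k).2 h

end Kernels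

/-! ## §3b At the record, Stage 13: the objects keyed to the limiting kernels of the MERGED TERM FAMILY OF RECORD, and the pinned reading -/

section Record

open scoped Matrix.Norms.L2Operator

variable (F : T4Family) (N : ℕ) [NeZero N]

/-- **WHAT THE N18 SLOT SAYS AT THE OBJECTS OF RECORD `objectsOfRecord₁₃ F N θ ℓ`** (any index `k`): for every member `b ∈ ]0, θ.γ]`,
every `g` of the record's window and every carrier point, the entries of RUN A's FUNCTIONAL OF RECORD at consecutive levels along the
prepended sequence are `ℓ.C₅·ℓ.θ₅^{j+1}·e^{−ℓ.κ|z|₁}`-close — by W1-19's `objectsOfRecord₁₃_EA_pt` these entries ARE the limiting (1.21)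
kernels of the merged term family of record. [cite: Balaban1987RG1, Thm 1 p.259, (1.21) p.264 and (1.6) p.261] -/
theorem n18At_u3OfRecord₁₃_objectsOfRecord₁₃_iff (θ : Stage13Params F N) (ℓ : U3Letters₁₁) (k : ℕ) :
    N18At (u3OfRecord₁₃ θ (objectsOfRecord₁₃ F N θ ℓ) k) ↔
      ∀ b : ℝ, 0 < b → b ≤ θ.γ → ∀ g ∈ Window θ.γ, ∀ (U : PUnit) (j : ℕ) (μ ν : Fin 4) (z : Fin 4 → ℤ),
        |(objectsOfRecord₁₃ F N θ ℓ).EA k g U (pt j μ ν z) -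
            (objectsOfRecord₁₃ F N θ ℓ).EA k (prependCoupling b g) U (pt (j + 1) μ ν z)| ≤
          ℓ.C₅ * ℓ.θ₅ ^ (j + 1) * Real.exp (-(ℓ.κ * l1 z)) := by
  refine forall₃_congr fun b _ _ => forall₂_congr fun g _ => ⟨fun h U j μ ν z => h U (pt j μ ν z), ?_⟩
  rintro h U ⟨j, μ, ν, z⟩
  exact h U j μ ν z

/-- **N18 AT THE OBJECTS OF RECORD FROM N22 AND ONE MEMBER** (`n18At_u3OfRecord₁₃_objects_of_n22At_of_member` at the merged term family
of record): `N22At` at the bundle of record (any index), `ℓ.Signs`, `ℓ.ω ≤ ℓ.θ₅`, and NE5 between run A's functional of record and ONE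
member `b₀ ∈ ]0, θ.γ]` of run B's family of record with constant `ℓ.C₅ − ℓ.C₉·θ.γ` ⟹ `N18At` at the bundle of record (every index).
[cite: Balaban1987RG1, Thm 1 p.259 and §5 p.298] -/
theorem n18At_u3OfRecord₁₃_objectsOfRecord₁₃_of_n22At_of_member (θ : Stage13Params F N) (ℓ : U3Letters₁₁) (hs : ℓ.Signs)
    (hωθ : ℓ.ω ≤ ℓ.θ₅) (k k' : ℕ) (h22 : N22At (u3OfRecord₁₃ θ (objectsOfRecord₁₃ F N θ ℓ) k')) {b₀ : ℝ} (hb₀ : 0 < b₀)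
    (hb₀γ : b₀ ≤ θ.γ)
    (h5 : NE5 ((objectsOfRecord₁₃ F N θ ℓ).EA k) ((objectsOfRecord₁₃ F N θ ℓ).EB k b₀) (Window θ.γ) ℓ.κ ℓ.θ₅
      (ℓ.C₅ - ℓ.C₉ * θ.γ)) :
    N18At (u3OfRecord₁₃ θ (objectsOfRecord₁₃ F N θ ℓ) k) := by
  letI := θ.instVβ₁; letI := θ.instVβ₂; letI := θ.instιβ
  have hobj : objectsOfRecord₁₃ F N θ ℓ =
      objects F (Node00.mergedTermFamilyMatT F N (Node00.TβOfRecord₁₃ F N) (Node00.chiβOfRecord₁₃ F N θ) θ.εbg) θ.ρ8 θ.bV ℓ := rfl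
  rw [hobj] at h22 h5 ⊢
  exact n18At_u3OfRecord₁₃_objects_of_n22At_of_member F _ θ.ρ8 θ.bV θ ℓ hs hωθ k k' h22 hb₀ hb₀γ h5

variable {N}

/-- **PIN FORM, READING SIDE** (the shape a `stub_rates13H` prover meets): if at a Stage-13 tuple with core provisos the reading's node-U3
objects ARE the kernel objects of record (`hpin`, n18-w2's pin shape), the N18 conjunct at EVERY run-length bundle
`(rateCarriersOfRecord₁₃CoPH 𝔯 F θ hP g₀ os k).u3` READS as the consecutive-level closeness of run A's functional of record along prepended
sequences (`n18At_u3OfRecord₁₃_objectsOfRecord₁₃_iff`). [cite: Balaban1987RG1, Thm 1 p.259 and (1.21) p.264] -/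
theorem n18At_rateCarriers_of_kernels_pin_iff (𝔯 : RateReading₁₃CoPH N) (θ : Stage13HParams F N)
    (hP : θ.Provisos₁₃CoPH F N) (g₀ : ℕ → ℝ) (os : List (ULoop F)) (ℓ : U3Letters₁₁)
    (hpin : (𝔯.lit F θ hP g₀ os).u3 = objectsOfRecord₁₃ F N θ.toStage13Params ℓ) (k : ℕ) :
    N18At (rateCarriersOfRecord₁₃CoPH 𝔯 F θ hP g₀ os k).u3 ↔
      ∀ b : ℝ, 0 < b → b ≤ θ.γ → ∀ g ∈ Window θ.γ, ∀ (U : PUnit) (j : ℕ) (μ ν : Fin 4) (z : Fin 4 → ℤ),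
        |(objectsOfRecord₁₃ F N θ.toStage13Params ℓ).EA k g U (pt j μ ν z) -
            (objectsOfRecord₁₃ F N θ.toStage13Params ℓ).EA k (prependCoupling b g) U (pt (j + 1) μ ν z)| ≤
          ℓ.C₅ * ℓ.θ₅ ^ (j + 1) * Real.exp (-(ℓ.κ * l1 z)) := by
  show N18At (u3OfRecord₁₃ θ.toStage13Params (𝔯.lit F θ hP g₀ os).u3 k) ↔ _
  rw [hpin]
  exact n18At_u3OfRecord₁₃_objectsOfRecord₁₃_iff F N θ.toStage13Params ℓ k

/-- **PIN FORM OF THE FAMILY REDUCTION**: under the pin, `N22At` at ANY run-length bundle of the reading, `ℓ.Signs`, `ℓ.ω ≤ ℓ.θ₅` and NE5 at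
ONE member with constant `ℓ.C₅ − ℓ.C₉·θ.γ` give the N18 conjunct at EVERY run-length bundle of the reading — in particular at the selected
one `ksel …` of the K3⁷ v2 skeleton's `KeyedRatesHolderD4`. [cite: Balaban1987RG1, Thm 1 p.259 and §5 p.298] -/
theorem n18At_rateCarriers_of_kernels_pin_of_n22At_of_member (𝔯 : RateReading₁₃CoPH N) (θ : Stage13HParams F N)
    (hP : θ.Provisos₁₃CoPH F N) (g₀ : ℕ → ℝ) (os : List (ULoop F)) (ℓ : U3Letters₁₁)
    (hpin : (𝔯.lit F θ hP g₀ os).u3 = objectsOfRecord₁₃ F N θ.toStage13Params ℓ) (hs : ℓ.Signs) (hωθ : ℓ.ω ≤ ℓ.θ₅)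
    (k k' : ℕ) (h22 : N22At (rateCarriersOfRecord₁₃CoPH 𝔯 F θ hP g₀ os k').u3) {b₀ : ℝ} (hb₀ : 0 < b₀) (hb₀γ : b₀ ≤ θ.γ)
    (h5 : NE5 ((objectsOfRecord₁₃ F N θ.toStage13Params ℓ).EA k) ((objectsOfRecord₁₃ F N θ.toStage13Params ℓ).EB k b₀)
      (Window θ.γ) ℓ.κ ℓ.θ₅ (ℓ.C₅ - ℓ.C₉ * θ.γ)) :
    N18At (rateCarriersOfRecord₁₃CoPH 𝔯 F θ hP g₀ os k).u3 := by
  change N22At (u3OfRecord₁₃ θ.toStage13Params (𝔯.lit F θ hP g₀ os).u3 k') at h22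
  show N18At (u3OfRecord₁₃ θ.toStage13Params (𝔯.lit F θ hP g₀ os).u3 k)
  rw [hpin] at h22 ⊢
  exact n18At_u3OfRecord₁₃_objectsOfRecord₁₃_of_n22At_of_member F N θ.toStage13Params ℓ hs hωθ k k' h22 hb₀ hb₀γ h5

end Record

/-! ## §4 The tower twin (`U3Tower₁₁`: `EB k b = E (k+1) ∘ prepend b`): N22 at level `k + 1` reduces N18's family at level `k` -/

section Tower

variable (t : U3Tower₁₁)

/-- **THE FAMILY FROM ONE MEMBER ON A TOWER READING**: run B's family at level `k` is the level-`(k+1)` functional along the prepended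
sequence (`U3Tower₁₁.EB`, `rfl`); the scale `k − r X` does not exceed `k + 1 − r X`; so NE9 with fading-memory moduli for the
LEVEL-`(k+1)` functional and NE5 at ONE member at level `k` give NE5 at every member at level `k`, constant `C₅ + C₉γ`.
[cite: Balaban1987RG1, Thm 1 p.259 and §5 p.298] -/
theorem ne5_tower_family_of_member (k : ℕ) {γ κ C₉ ω : ℝ} {Λ : ℕ → ℕ → ℝ}
    (h9 : NE9 (t.EA (k + 1)) (Window γ) κ Λ) (hΛ : FadingMemory C₉ ω Λ) (hω0 : 0 ≤ ω) {θ C₅ : ℝ} (hωθ : ω ≤ θ)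
    (hθ1 : θ ≤ 1) {b₀ : ℝ} (hb₀ : 0 < b₀) (hb₀γ : b₀ ≤ γ) (h5 : NE5 (t.EA k) (t.EB k b₀) (Window γ) κ θ C₅) :
    ∀ b : ℝ, 0 < b → b ≤ γ → NE5 (t.EA k) (t.EB k b) (Window γ) κ θ (C₅ + C₉ * γ) :=
  ne5_family_of_member (C := t.levelCarriers k) (C' := t.levelCarriers (k + 1)) (t.EA k) (t.EA (k + 1)) (t.EB k) id id
    (fun X => Nat.sub_le_sub_right (Nat.le_succ k) (t.r X)) (fun _ => rfl) (fun _ _ _ _ => rfl)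
    (fun _ hb hbγ _ hg => prependCoupling_mem_window hb hbγ hg) h9 hΛ hω0 hωθ hθ1 hb₀ hb₀γ h5

variable {N : ℕ} [NeZero N] {F : T4Family}

/-- **N18 AT LEVEL `k` OF A TOWER READING'S ₁₃ BUNDLE FROM N22 AT LEVEL `k + 1` AND ONE MEMBER**: `N22At (u3OfRecord₁₃ θ (t.objects ℓ) (k+1))`,
`ℓ.Signs`, `ℓ.ω ≤ ℓ.θ₅`, NE5 at one member `b₀ ∈ ]0, θ.γ]` at level `k` with constant `ℓ.C₅ − ℓ.C₉·θ.γ` ⟹ `N18At (u3OfRecord₁₃ θ (t.objects ℓ) k)`.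
[cite: Balaban1987RG1, Thm 1 p.259 and §5 p.298] -/
theorem n18At_u3OfRecord₁₃_tower_of_n22At_succ_of_member (θ : Stage13Params F N) (ℓ : U3Letters₁₁) (hs : ℓ.Signs)
    (hωθ : ℓ.ω ≤ ℓ.θ₅) (k : ℕ) (h22 : N22At (u3OfRecord₁₃ θ (t.objects ℓ) (k + 1))) {b₀ : ℝ} (hb₀ : 0 < b₀)
    (hb₀γ : b₀ ≤ θ.γ) (h5 : NE5 (t.EA k) (t.EB k b₀) (Window θ.γ) ℓ.κ ℓ.θ₅ (ℓ.C₅ - ℓ.C₉ * θ.γ)) :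
    N18At (u3OfRecord₁₃ θ (t.objects ℓ) k) := by
  have h9 : NE9 (t.EA (k + 1)) (Window θ.γ) ℓ.κ ℓ.moduli := h22.1
  have hΛ : FadingMemory ℓ.C₉ ℓ.ω ℓ.moduli := h22.2
  have h := ne5_tower_family_of_member t k h9 hΛ hs.ω_nonneg hωθ hs.θ₅_lt_one.le hb₀ hb₀γ h5
  rw [sub_add_cancel] at h
  exact h

end Tower

end YMDAG.N18.AtU3OfKernels

end
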